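import Mathlib
import HarnessLib
import Summits.Langlands.Langlands.Theses.QuarterDeficit1951
import Summits.Langlands.Langlands.Theorems.ParityBlindBianchiArtinWeightRealisationLevelSolvableSector
import Literature.NumberTheory.Automorphic.StrongArtinCentralCharacter
import Literature.NumberTheory.Automorphic.AutomorphicRepsGL2WeightOneCleanModel
import Literature.NumberTheory.Automorphic.NewformAdelisationHeckeOperator
import Literature.NumberTheory.Automorphic.CertifiedMaassHeckeTraceCensus
import Literature.NumberTheory.Automorphic.HyperbolicLaplaceSpectrum
import Summits.Langlands.Langlands.Theorems.QuarterDeficit1951CorrespondentFingerprintStubBarrier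
import Summits.Langlands.Langlands.Theorems.QuarterDeficit1951CorrespondentFingerprintStubArchParameter
import Summits.Langlands.Langlands.Theorems.QuarterDeficit1951CorrespondentFingerprintStubCentralCharacter
import Summits.Langlands.Langlands.Theorems.QuarterDeficit1951CorrespondentFingerprintStubSatakeSmallPrimes
import Summits.Langlands.Langlands.Theorems.QuarterDeficit1951CorrespondentFingerprintStubGlue
import Summits.Langlands.Langlands.Theorems.QuarterDeficit1951CorrespondentFingerprintStubLevelOneSpherical
import Summits.Langlands.Langlands.Theorems.QuarterDeficit1951CorrespondentFingerprintStubLevelOneAssembly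

/-!
# Composition lemmas for crux stmt-Langlands-15898 `QuarterDeficit1951.CorrespondentFingerprint`, line `Sketch`

Elementary lemmas used by the composition of the crux from its stubs: the determinant of the
contragredient transport at a Frobenius, evenness of order-`5` Dirichlet characters, the period
integral of a `1`-periodic function over `[0, n]`, the place of `ℚ` over a rational prime, and the
icosahedral fingerprint algebra `T²/D ∈ Φ = {0, 1, 4, (3 ± √5)/2}` (registered sub-goal
`stub_composition_fingerprint`).
-/

set_option linter.dupNamespace false

noncomputable section

open scoped BigOperators Matrix NumberField MatrixGroups NNReal Polynomial ComplexConjugate Classical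
open Literature.NumberTheory.Automorphic Literature.NumberTheory.GaloisRepresentations
  IsDedekindDomain NumberField Filter Polynomial
open Literature.NumberTheory.Automorphic.GL2Real
open Rat.HeightOneSpectrum
open Summit.Langlands

namespace Summit.Langlands.Langlands.Theorems.CorrespondentFingerprint

/-! ## Composition: in-file lemmas -/

/-- **Determinant of the contragredient transport at a Frobenius.**  For `τ g = ι(((ρ g)⁻¹)ᵀ)` and
`charpoly ρ(Frob_v) = X² - tX + d` (arithmetic Frobenius): `det τ(Frob_v) = (ι d)⁻¹`
(`det (M⁻¹)ᵀ = (det M)⁻¹` and `det M` is the constant coefficient of a monic quadratic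
characteristic polynomial). [folklore] -/
theorem det_dual_transport_eq_inv {ℓ : ℕ} [Fact ℓ.Prime] (ι : PadicAlgCl ℓ ≃+* ℂ)
    (ρ : FramedGaloisRep ℚ (PadicAlgCl ℓ) 2) (τ : FramedArtinRep ℚ 2)
    (hτ : ∀ g : Field.absoluteGaloisGroup ℚ, ((τ g : GL (Fin 2) ℂ) : Matrix (Fin 2) (Fin 2) ℂ) =
      ((((ρ g)⁻¹ : GL (Fin 2) (PadicAlgCl ℓ)) : Matrix (Fin 2) (Fin 2) (PadicAlgCl ℓ))ᵀ).map
        (ι : PadicAlgCl ℓ → ℂ))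
    {v : HeightOneSpectrum (𝓞 ℚ)} {t d : PadicAlgCl ℓ}
    (hP : ρ.HasFrobCharpolyAt v (X ^ 2 - C t * X + C d))
    {𝔓 : Ideal (absIntegers (𝓞 ℚ) ℚ)} (h𝔓 : 𝔓 ∈ v.primesAbove)
    {Φ : Field.absoluteGaloisGroup ℚ} (hΦ : IsArithFrobAt (𝓞 ℚ) Φ 𝔓) :
    ((FramedRep.det τ Φ : ℂˣ) : ℂ) = (ι d)⁻¹ := by
  have hchar : (((ρ Φ : GL (Fin 2) (PadicAlgCl ℓ)) : Matrix (Fin 2) (Fin 2) (PadicAlgCl ℓ))).charpoly =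
      X ^ 2 - C t * X + C d := hP 𝔓 h𝔓 Φ hΦ
  have hdetρ : (((ρ Φ : GL (Fin 2) (PadicAlgCl ℓ)) : Matrix (Fin 2) (Fin 2) (PadicAlgCl ℓ))).det = d := by
    rw [Matrix.det_eq_sign_charpoly_coeff, hchar]
    simp
  have hdetinv : ((((ρ Φ)⁻¹ : GL (Fin 2) (PadicAlgCl ℓ)) :
      Matrix (Fin 2) (Fin 2) (PadicAlgCl ℓ))).det = d⁻¹ := by
    rw [← Matrix.GeneralLinearGroup.val_det_apply, map_inv, Units.val_inv_eq_inv_val,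
      Matrix.GeneralLinearGroup.val_det_apply, hdetρ]
  rw [FramedRep.det_apply, Matrix.GeneralLinearGroup.val_det_apply, hτ Φ]
  have hmap : ((((ρ Φ)⁻¹ : GL (Fin 2) (PadicAlgCl ℓ)) : Matrix (Fin 2) (Fin 2) (PadicAlgCl ℓ))ᵀ).map
      (ι : PadicAlgCl ℓ → ℂ) =
      (ι : PadicAlgCl ℓ →+* ℂ).mapMatrix
        ((((ρ Φ)⁻¹ : GL (Fin 2) (PadicAlgCl ℓ)) : Matrix (Fin 2) (Fin 2) (PadicAlgCl ℓ))ᵀ) := by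
    rw [RingHom.mapMatrix_apply]
    rfl
  rw [hmap, ← RingHom.map_det, Matrix.det_transpose, hdetinv, RingHom.coe_coe, map_inv₀]

/-- A Dirichlet character of order `5` is even: `χ(-1) = 1` (`χ(-1) = ±1` and `χ⁵ = 1`).
[folklore] -/
theorem dirichletCharacter_neg_one_of_orderOf_eq_five {N : ℕ} (χ : DirichletCharacter ℂ N)
    (h : orderOf χ = 5) : χ (-1) = 1 := by
  rcases χ.even_or_odd with he | ho
  · exact he
  · exfalso
    have h5 : χ ^ 5 = 1 := h ▸ pow_orderOf_eq_one χ
    have h1 : (χ ^ 5) (((-1 : (ZMod N)ˣ) : ZMod N)) = 1 := by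
      rw [h5, MulChar.one_apply_coe]
    rw [MulChar.pow_apply_coe, Units.val_neg, Units.val_one, ho] at h1
    norm_num at h1

/-- For a continuous `1`-periodic `f : ℝ → ℂ`, `∫₀ⁿ f = n ∫₀¹ f`. [folklore] -/
theorem intervalIntegral_zero_nat_of_periodic {f : ℝ → ℂ} (hf : Function.Periodic f 1)
    (hc : Continuous f) (n : ℕ) :
    ∫ x in (0 : ℝ)..(n : ℝ), f x = (n : ℂ) * ∫ x in (0 : ℝ)..1, f x := by
  induction n with
  | zero => simp
  | succ n ih =>
    rw [Nat.cast_succ, ← intervalIntegral.integral_add_adjacent_intervals (hc.intervalIntegrable 0 n)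
      (hc.intervalIntegrable (n : ℝ) ((n : ℝ) + 1)), ih]
    have h := hf.intervalIntegral_add_eq (n : ℝ) 0
    rw [zero_add] at h
    rw [h]
    push_cast
    ring

/-- **The icosahedral fingerprint from the Frobenius data**: if `T² = 0 ∨ T² = D ∨ T² = 4D ∨
T⁴ - 3DT² + D² = 0` with `D ≠ 0` then `T²/D ∈ Φ = {0, 1, 4, (3 ± √5)/2}` (the roots of
`x² - 3x + 1` are `(3 ± √5)/2`). [folklore] -/
theorem sq_div_mem_fingerprint {T D : ℂ} (hD : D ≠ 0)
    (h : T ^ 2 = 0 ∨ T ^ 2 = D ∨ T ^ 2 = 4 * D ∨ T ^ 4 - 3 * D * T ^ 2 + D ^ 2 = 0) :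
    T ^ 2 / D ∈ ({0, 1, 4, (((3 + Real.sqrt 5) / 2 : ℝ) : ℂ), (((3 - Real.sqrt 5) / 2 : ℝ) : ℂ)} : Set ℂ) := by
  simp only [Set.mem_insert_iff, Set.mem_singleton_iff]
  rcases h with h | h | h | h
  · exact Or.inl (by rw [h, zero_div])
  · exact Or.inr (Or.inl (by rw [h, div_self hD]))
  · exact Or.inr (Or.inr (Or.inl (by rw [h, mul_div_assoc, div_self hD, mul_one])))
  · right; right; right
    have h5 : (((Real.sqrt 5 : ℝ)) : ℂ) ^ 2 = 5 := by
      rw [← Complex.ofReal_pow, Real.sq_sqrt (by norm_num : (0 : ℝ) ≤ 5)]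
      norm_num
    have hF : (T ^ 2 / D) ^ 2 - 3 * (T ^ 2 / D) + 1 = 0 := by
      have : (T ^ 2 / D) ^ 2 - 3 * (T ^ 2 / D) + 1 = (T ^ 4 - 3 * D * T ^ 2 + D ^ 2) / D ^ 2 := by
        field_simp
      rw [this, h, zero_div]
    have hprod : (T ^ 2 / D - (((3 + Real.sqrt 5) / 2 : ℝ) : ℂ)) *
        (T ^ 2 / D - (((3 - Real.sqrt 5) / 2 : ℝ) : ℂ)) = 0 := by
      have e : (T ^ 2 / D - (((3 + Real.sqrt 5) / 2 : ℝ) : ℂ)) *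
          (T ^ 2 / D - (((3 - Real.sqrt 5) / 2 : ℝ) : ℂ)) =
          (T ^ 2 / D) ^ 2 - 3 * (T ^ 2 / D) + (9 - (((Real.sqrt 5 : ℝ)) : ℂ) ^ 2) / 4 := by
        push_cast
        ring
      rw [e, h5]
      linear_combination hF
    rcases mul_eq_zero.mp hprod with h1 | h1
    · exact Or.inl (sub_eq_zero.mp h1)
    · exact Or.inr (sub_eq_zero.mp h1)



/-- **Registered sub-goal `stub_composition_fingerprint`** (closed form of `sq_div_mem_fingerprint`).
[folklore] -/
theorem stub_composition_fingerprint : ∀ (T D : ℂ), D ≠ 0 → (T ^ 2 = 0 ∨ T ^ 2 = D ∨ T ^ 2 = 4 * D ∨ T ^ 4 - 3 * D * T ^ 2 + D ^ 2 = 0) → T ^ 2 / D ∈ ({0, 1, 4, (((3 + Real.sqrt 5) / 2 : ℝ) : ℂ), (((3 - Real.sqrt 5) / 2 : ℝ) : ℂ)} : Set ℂ) :=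
  fun _ _ hD h => sq_div_mem_fingerprint hD h

end Summit.Langlands.Langlands.Theorems.CorrespondentFingerprint

end
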